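import Mathlib.Analysis.SpecificLimits.Basic
import Mathlib.Analysis.MeanInequalities
import Mathlib.MeasureTheory.Measure.Haar.InnerProductSpace
import Literature.Geometry.Lorentzian.Basic

/-!
# Route ClusterCompleteness — crux `AdiabaticMultiKerrILED`, line `Sketch`: constant at infinity,
# auxiliary inequalities (series and dyadic shells)

Helper file for the crux `stmt-FinalStateConjecture-14310`
(`Summit.FinalStateConjecture.FinalStateConjecture.Theses.ClusterCompleteness.AdiabaticMultiKerrILED`),
stub `stub_constantAtInfinity` of line `Sketch` (a `C¹` function with finite Dirichlet energy
outside a ball of `ℝ³` has a constant at infinity in the Hardy sense). The stub is proved by a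
dyadic covering of the exterior by balls, the Poincaré inequality on each ball, comparison of the
means of overlapping balls, and a discrete Hardy inequality for the sequence of means. This file
holds the measure-free ingredients (namespace `….Sketch.ConstantAtInfinity`):

* `tsum_sq_le_tsum_mul_tsum` — Cauchy–Schwarz for series in `ℝ≥0∞`;
* `discrete_hardy` — if `2^k (a_{k+1} − a_k)² ≤ K E_k` then, with `c = lim a_k`,
  `∑ 2^k (a_k − c)² ≤ 12 K ∑ E_k`;
* `tsum_setLIntegral_dyadic_le` — bounded overlap of the thick dyadic shells
  `{R 2^k < ‖y‖ ≤ R 2^{k+7}}` of `ℝ³`: `∑_k ∫_{shell k} G ≤ 7 ∫_{R < ‖y‖} G`.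

Standard real analysis. [folklore]
-/

noncomputable section

-- the doubled `FinalStateConjecture.FinalStateConjecture` path component trips dupNamespace
set_option linter.dupNamespace false

open scoped ENNReal NNReal Topology
open MeasureTheory Set Metric Filter Literature.Geometry.Lorentzian

namespace Summit.FinalStateConjecture.FinalStateConjecture.Cruxes.AdiabaticMultiKerrILED.Sketch.ConstantAtInfinity

/-! ### Cauchy–Schwarz and the discrete Hardy inequality -/

/-- **Cauchy–Schwarz for series in `ℝ≥0∞`**: if `d_j² ≤ x_j y_j` for all `j` then
`(∑ d_j)² ≤ (∑ x_j) (∑ y_j)` (Hölder with `p = q = 2` on finite sets, then suprema). [folklore] -/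
theorem tsum_sq_le_tsum_mul_tsum {ι : Type*} (d x y : ι → ℝ≥0∞)
    (h : ∀ j, d j ^ 2 ≤ x j * y j) :
    (∑' j, d j) ^ 2 ≤ (∑' j, x j) * ∑' j, y j := by
  classical
  have hhalf : ∀ z : ℝ≥0∞, (z ^ (1 / 2 : ℝ)) ^ (2 : ℝ) = z := fun z => by
    rw [← ENNReal.rpow_mul]; norm_num
  have hhalf' : ∀ z : ℝ≥0∞, (z ^ 2) ^ (1 / 2 : ℝ) = z := fun z => by
    rw [← ENNReal.rpow_two, ← ENNReal.rpow_mul]; norm_num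
  -- `d j ≤ √x_j √y_j`
  have h1 : ∀ j, d j ≤ x j ^ (1 / 2 : ℝ) * y j ^ (1 / 2 : ℝ) := by
    intro j
    have h2 : (d j ^ 2) ^ (1 / 2 : ℝ) ≤ (x j * y j) ^ (1 / 2 : ℝ) :=
      ENNReal.rpow_le_rpow (h j) (by norm_num)
    rwa [hhalf', ENNReal.mul_rpow_of_nonneg _ _ (by norm_num)] at h2
  have hfin : ∀ s : Finset ι,
      ∑ j ∈ s, d j ≤ (∑' j, x j) ^ (1 / 2 : ℝ) * (∑' j, y j) ^ (1 / 2 : ℝ) := by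
    intro s
    calc ∑ j ∈ s, d j ≤ ∑ j ∈ s, x j ^ (1 / 2 : ℝ) * y j ^ (1 / 2 : ℝ) :=
          Finset.sum_le_sum fun j _ => h1 j
      _ ≤ (∑ j ∈ s, (x j ^ (1 / 2 : ℝ)) ^ (2 : ℝ)) ^ (1 / (2 : ℝ)) *
            (∑ j ∈ s, (y j ^ (1 / 2 : ℝ)) ^ (2 : ℝ)) ^ (1 / (2 : ℝ)) :=
          ENNReal.inner_le_Lp_mul_Lq s _ _ Real.HolderConjugate.two_two
      _ = (∑ j ∈ s, x j) ^ (1 / 2 : ℝ) * (∑ j ∈ s, y j) ^ (1 / 2 : ℝ) := by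
          simp only [hhalf]
      _ ≤ (∑' j, x j) ^ (1 / 2 : ℝ) * (∑' j, y j) ^ (1 / 2 : ℝ) := by
          gcongr <;> exact ENNReal.sum_le_tsum _
  have htsum : ∑' j, d j ≤ (∑' j, x j) ^ (1 / 2 : ℝ) * (∑' j, y j) ^ (1 / 2 : ℝ) := by
    rw [ENNReal.tsum_eq_iSup_sum]
    exact iSup_le hfin
  calc (∑' j, d j) ^ 2 ≤ ((∑' j, x j) ^ (1 / 2 : ℝ) * (∑' j, y j) ^ (1 / 2 : ℝ)) ^ 2 :=
        pow_le_pow_left' htsum 2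
    _ = (∑' j, x j) * ∑' j, y j := by
        rw [mul_pow, ← ENNReal.rpow_two, ← ENNReal.rpow_two, hhalf, hhalf]

/-- Geometric series of `ENNReal.ofReal r`, `0 ≤ r < 1`: `∑ (ofReal r)^n = ofReal (1 − r)⁻¹`. [folklore] -/
theorem tsum_ofReal_pow {r : ℝ} (h0 : 0 ≤ r) (h1 : r < 1) :
    ∑' n : ℕ, ENNReal.ofReal r ^ n = ENNReal.ofReal (1 - r)⁻¹ := by
  simp_rw [← ENNReal.ofReal_pow h0]
  rw [← ENNReal.ofReal_tsum_of_nonneg (fun n => pow_nonneg h0 n) (summable_geometric_of_lt_one h0 h1),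
    tsum_geometric_of_lt_one h0 h1]

/-- **The discrete Hardy inequality.** Let `a : ℕ → ℝ`, `E : ℕ → [0, ∞]`, `K ∈ [0, ∞]` with
`2^k (a_{k+1} − a_k)² ≤ K E_k` for all `k`. Then there is `c : ℝ` (the limit of `a_k` when
`K ∑ E_k < ∞`) with `∑_k 2^k (a_k − c)² ≤ 12 K ∑_k E_k`. Proof: `|a_k − c| ≤ ∑_{j ≥ k} |a_{j+1} − a_j|`
and Cauchy–Schwarz with the weights `(3/4)^{j−k}`, `(2/3)^{j−k}`. [folklore] -/
theorem discrete_hardy (a : ℕ → ℝ) (E : ℕ → ℝ≥0∞) (K : ℝ≥0∞)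
    (h : ∀ k, 2 ^ k * ‖a (k + 1) - a k‖ₑ ^ 2 ≤ K * E k) :
    ∃ c : ℝ, ∑' k, 2 ^ k * ‖a k - c‖ₑ ^ 2 ≤ 12 * K * ∑' k, E k := by
  by_cases htop : K * ∑' k, E k = ⊤
  · refine ⟨0, ?_⟩
    rw [mul_assoc, htop, ENNReal.mul_top (by norm_num)]
    exact le_top
  -- increments and tails
  set δ : ℕ → ℝ := fun k => a (k + 1) - a k with hδ
  set T : ℕ → ℝ≥0∞ := fun k => ∑' i, ‖δ (k + i)‖ₑ with hT
  set G : ℕ → ℝ≥0∞ := fun k => ∑' i, ENNReal.ofReal (2 / 3) ^ i * E (k + i) with hG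
  have h2k : ∀ k : ℕ, (2⁻¹ : ℝ≥0∞) ^ k * 2 ^ k = 1 := fun k => by
    rw [← mul_pow, ENNReal.inv_mul_cancel two_ne_zero ENNReal.ofNat_ne_top, one_pow]
  have hd : ∀ k, ‖δ k‖ₑ ^ 2 ≤ K * E k * 2⁻¹ ^ k := fun k => by
    calc ‖δ k‖ₑ ^ 2 = 2⁻¹ ^ k * (2 ^ k * ‖a (k + 1) - a k‖ₑ ^ 2) := by
          rw [← mul_assoc, h2k, one_mul]
      _ ≤ 2⁻¹ ^ k * (K * E k) := mul_le_mul_right (h k) _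
      _ = K * E k * 2⁻¹ ^ k := by ring
  have h34 : ∑' i : ℕ, ENNReal.ofReal (3 / 4) ^ i = 4 := by
    rw [tsum_ofReal_pow (by norm_num) (by norm_num)]; norm_num
  have h23 : ∑' i : ℕ, ENNReal.ofReal (2 / 3) ^ i = 3 := by
    rw [tsum_ofReal_pow (by norm_num) (by norm_num)]; norm_num
  have hprod : ∀ i : ℕ, ENNReal.ofReal (3 / 4) ^ i * ENNReal.ofReal (2 / 3) ^ i = 2⁻¹ ^ i := by
    intro i
    rw [← mul_pow, ← ENNReal.ofReal_mul (by norm_num), ← ENNReal.ofReal_ofNat 2,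
      ← ENNReal.ofReal_inv_of_pos two_pos]
    norm_num
  -- Step 1: `2^k T_k² ≤ 4 K G_k`
  have step1 : ∀ k, 2 ^ k * T k ^ 2 ≤ 4 * K * G k := by
    intro k
    have hcs := tsum_sq_le_tsum_mul_tsum (fun i => ‖δ (k + i)‖ₑ)
      (fun i => ENNReal.ofReal (3 / 4) ^ i)
      (fun i => K * 2⁻¹ ^ k * (ENNReal.ofReal (2 / 3) ^ i * E (k + i))) (fun i => ?_)
    · rw [h34, ENNReal.tsum_mul_left] at hcs
      calc 2 ^ k * T k ^ 2 ≤ 2 ^ k * (4 * (K * 2⁻¹ ^ k * G k)) := mul_le_mul_right hcs _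
        _ = (2⁻¹ ^ k * 2 ^ k) * (4 * K * G k) := by ring
        _ = 4 * K * G k := by rw [h2k, one_mul]
    · calc ‖δ (k + i)‖ₑ ^ 2 ≤ K * E (k + i) * 2⁻¹ ^ (k + i) := hd (k + i)
        _ = K * E (k + i) * 2⁻¹ ^ k * (ENNReal.ofReal (3 / 4) ^ i * ENNReal.ofReal (2 / 3) ^ i) := by
            rw [hprod, pow_add]; ring
        _ = _ := by ring
  -- Step 2: `∑_k G_k ≤ 3 ∑ E`
  have step2 : ∑' k, G k ≤ 3 * ∑' k, E k := by
    calc ∑' k, G k = ∑' i, ∑' k, ENNReal.ofReal (2 / 3) ^ i * E (k + i) := ENNReal.tsum_comm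
      _ = ∑' i, ENNReal.ofReal (2 / 3) ^ i * ∑' k, E (k + i) := by
          simp_rw [ENNReal.tsum_mul_left]
      _ ≤ ∑' i, ENNReal.ofReal (2 / 3) ^ i * ∑' k, E k := by
          refine ENNReal.tsum_le_tsum fun i => mul_le_mul_right ?_ _
          exact ENNReal.tsum_comp_le_tsum_of_injective (add_left_injective i) E
      _ = 3 * ∑' k, E k := by rw [ENNReal.tsum_mul_right, h23]
  have hmain : ∑' k, 2 ^ k * T k ^ 2 ≤ 12 * K * ∑' k, E k := by
    calc ∑' k, 2 ^ k * T k ^ 2 ≤ ∑' k, 4 * K * G k := ENNReal.tsum_le_tsum step1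
      _ = 4 * K * ∑' k, G k := ENNReal.tsum_mul_left
      _ ≤ 4 * K * (3 * ∑' k, E k) := mul_le_mul_right step2 _
      _ = 12 * K * ∑' k, E k := by ring
  -- Step 3: the limit `c`
  have hfin : 12 * K * ∑' k, E k ≠ ⊤ := by
    rw [show (12 : ℝ≥0∞) * K * ∑' k, E k = 12 * (K * ∑' k, E k) by ring]
    exact ENNReal.mul_ne_top (by norm_num) htop
  have hT0 : T 0 ≠ ⊤ := by
    intro hT0
    have h1 : 2 ^ 0 * T 0 ^ 2 ≤ ∑' k, 2 ^ k * T k ^ 2 := ENNReal.le_tsum 0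
    rw [hT0, pow_zero, one_mul, ENNReal.top_pow two_ne_zero, top_le_iff] at h1
    exact hfin (top_le_iff.1 (h1 ▸ hmain))
  have hsum : Summable δ := by
    have h1 : ∑' i, (‖δ i‖₊ : ℝ≥0∞) ≠ ⊤ := by
      simpa only [hT, zero_add, enorm_eq_nnnorm] using hT0
    have h2 : Summable fun i => ‖δ i‖₊ := ENNReal.tsum_coe_ne_top_iff_summable.1 h1
    exact Summable.of_norm (by simpa only [coe_nnnorm] using NNReal.summable_coe.2 h2)
  refine ⟨a 0 + ∑' i, δ i, le_trans (ENNReal.tsum_le_tsum fun k => ?_) hmain⟩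
  -- `‖a_k − c‖ₑ ≤ T_k`
  have hck : a 0 + ∑' i, δ i - a k = ∑' i, δ (i + k) := by
    rw [← hsum.sum_add_tsum_nat_add k, Finset.sum_range_sub]
    ring
  have hle : ‖a k - (a 0 + ∑' i, δ i)‖ₑ ≤ T k := by
    rw [← enorm_neg, neg_sub, hck, hT]
    calc ‖∑' i, δ (i + k)‖ₑ ≤ ∑' i, ‖δ (i + k)‖ₑ := enorm_tsum_le_tsum_enorm
      _ = ∑' i, ‖δ (k + i)‖ₑ := by simp_rw [add_comm _ k]
      _ = _ := rfl
  exact mul_le_mul_right (pow_le_pow_left' hle 2) _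

/-! ### Dyadic bounded overlap -/

/-- Every `t ∈ (1, 2^n]` lies in a dyadic interval `(2^i, 2^{i+1}]` with `i < n`. [folklore] -/
theorem exists_dyadic_Ioc {t : ℝ} {n : ℕ} (h1 : 1 < t) (h2 : t ≤ 2 ^ n) :
    ∃ i < n, (2 : ℝ) ^ i < t ∧ t ≤ 2 ^ (i + 1) := by
  induction n with
  | zero => exact absurd (h1.trans_le (by simpa using h2)) (lt_irrefl _)
  | succ n ih =>
    by_cases h : t ≤ 2 ^ n
    · obtain ⟨i, hi, h3, h4⟩ := ih h
      exact ⟨i, Nat.lt_succ_of_lt hi, h3, h4⟩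
    · exact ⟨n, n.lt_succ_self, not_le.1 h, h2⟩

/-- **Bounded overlap of the thick dyadic shells**: for `R > 0` and any `G : ℝ³ → [0, ∞]`,
`∑_k ∫_{R 2^k < ‖y‖ ≤ R 2^{k+7}} G ≤ 7 ∫_{R < ‖y‖} G` (each thick shell is a union of `7` of the
pairwise disjoint thin shells `{R 2^j < ‖y‖ ≤ R 2^{j+1}} ⊆ {R < ‖y‖}`). [folklore] -/
theorem tsum_setLIntegral_dyadic_le (G : E3 → ℝ≥0∞) {R : ℝ} (hR : 0 < R) :
    ∑' k : ℕ, ∫⁻ y in {y : E3 | R * 2 ^ k < ‖y‖ ∧ ‖y‖ ≤ R * 2 ^ (k + 7)}, G y ≤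
      7 * ∫⁻ y in {y : E3 | R < ‖y‖}, G y := by
  set sh : ℕ → Set E3 := fun j => {y | R * 2 ^ j < ‖y‖ ∧ ‖y‖ ≤ R * 2 ^ (j + 1)} with hsh
  have hshm : ∀ j, MeasurableSet (sh j) := fun j =>
    (isOpen_lt continuous_const continuous_norm).measurableSet.inter
      (isClosed_le continuous_norm continuous_const).measurableSet
  have hdisj : Pairwise (Function.onFun Disjoint sh) := by
    intro j j' hne
    wlog hlt : j < j' generalizing j j'
    · exact (this hne.symm (lt_of_le_of_ne (not_lt.1 hlt) hne.symm)).symm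
    refine disjoint_left.2 fun y hy hy' => ?_
    have h1 : R * 2 ^ (j + 1) ≤ R * 2 ^ j' :=
      mul_le_mul_of_nonneg_left (pow_le_pow_right₀ one_le_two hlt) hR.le
    exact absurd (hy'.1.trans_le (hy.2.trans h1)) (lt_irrefl _)
  -- each thick shell is covered by seven thin shells
  have hcover : ∀ k : ℕ,
      {y : E3 | R * 2 ^ k < ‖y‖ ∧ ‖y‖ ≤ R * 2 ^ (k + 7)} ⊆ ⋃ i : Fin 7, sh (k + i) := by
    intro k y hy
    have hRk : 0 < R * 2 ^ k := by positivity
    obtain ⟨i, hi, h3, h4⟩ := exists_dyadic_Ioc (t := ‖y‖ / (R * 2 ^ k)) (n := 7)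
      ((one_lt_div hRk).2 hy.1) (by
        rw [div_le_iff₀ hRk]
        calc ‖y‖ ≤ R * 2 ^ (k + 7) := hy.2
          _ = 2 ^ 7 * (R * 2 ^ k) := by ring)
    refine mem_iUnion.2 ⟨⟨i, hi⟩, ?_, ?_⟩
    · have h5 := (lt_div_iff₀ hRk).1 h3
      calc R * 2 ^ (k + (i : ℕ)) = 2 ^ i * (R * 2 ^ k) := by ring
        _ < ‖y‖ := h5
    · have h5 := (div_le_iff₀ hRk).1 h4
      calc ‖y‖ ≤ 2 ^ (i + 1) * (R * 2 ^ k) := h5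
        _ = R * 2 ^ (k + (i : ℕ) + 1) := by ring
  have hunion : (⋃ j, sh j) ⊆ {y : E3 | R < ‖y‖} := iUnion_subset fun j y hy =>
    lt_of_le_of_lt (le_mul_of_one_le_right hR.le (one_le_pow₀ one_le_two)) hy.1
  calc ∑' k : ℕ, ∫⁻ y in {y : E3 | R * 2 ^ k < ‖y‖ ∧ ‖y‖ ≤ R * 2 ^ (k + 7)}, G y
      ≤ ∑' k : ℕ, ∫⁻ y in ⋃ i : Fin 7, sh (k + i), G y :=
        ENNReal.tsum_le_tsum fun k => lintegral_mono_set (hcover k)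
    _ ≤ ∑' k : ℕ, ∑' i : Fin 7, ∫⁻ y in sh (k + i), G y :=
        ENNReal.tsum_le_tsum fun k => lintegral_iUnion_le _ _
    _ = ∑' i : Fin 7, ∑' k : ℕ, ∫⁻ y in sh (k + i), G y := ENNReal.tsum_comm
    _ ≤ ∑' i : Fin 7, ∑' j : ℕ, ∫⁻ y in sh j, G y :=
        ENNReal.tsum_le_tsum fun i =>
          ENNReal.tsum_comp_le_tsum_of_injective (add_left_injective (i : ℕ))
            (fun j => ∫⁻ y in sh j, G y)
    _ = 7 * ∑' j : ℕ, ∫⁻ y in sh j, G y := by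
        rw [tsum_fintype, Finset.sum_const, Finset.card_univ, Fintype.card_fin, nsmul_eq_mul]
        rfl
    _ = 7 * ∫⁻ y in ⋃ j, sh j, G y := by rw [lintegral_iUnion hshm hdisj]
    _ ≤ 7 * ∫⁻ y in {y : E3 | R < ‖y‖}, G y := mul_le_mul_right (lintegral_mono_set hunion) _

end Summit.FinalStateConjecture.FinalStateConjecture.Cruxes.AdiabaticMultiKerrILED.Sketch.ConstantAtInfinity

namespace Summit.FinalStateConjecture.FinalStateConjecture.Cruxes.AdiabaticMultiKerrILED.Sketch

/-- **Registered sub-goal of `stub_constantAtInfinity` (file `…Aux`)**: bounded overlap of the thick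
dyadic shells of `ℝ³`, `∑_k ∫_{R 2^k < ‖y‖ ≤ R 2^{k+7}} G ≤ 7 ∫_{R < ‖y‖} G`
(`ConstantAtInfinity.tsum_setLIntegral_dyadic_le`). [folklore] -/
theorem stub_constantAtInfinity_shells :
    ∀ (G : E3 → ℝ≥0∞) (R : ℝ), 0 < R →
      ∑' k : ℕ, ∫⁻ y in {y : E3 | R * 2 ^ k < ‖y‖ ∧ ‖y‖ ≤ R * 2 ^ (k + 7)}, G y ≤
        7 * ∫⁻ y in {y : E3 | R < ‖y‖}, G y :=
  fun G _ hR => ConstantAtInfinity.tsum_setLIntegral_dyadic_le G hR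

end Summit.FinalStateConjecture.FinalStateConjecture.Cruxes.AdiabaticMultiKerrILED.Sketch

end
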